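import Literature.NumberTheory.Automorphic.TwistedQuotientLevelChangeNilpotent
import Literature.NumberTheory.Automorphic.ArithmeticQuotientTwistedComparison
import Literature.NumberTheory.Automorphic.CompletedCohomology
import Summits.Langlands.Langlands.Theses.ParityBlindBianchi
import Mathlib.Algebra.Homology.ShortComplex.Linear
import Mathlib.Algebra.Homology.Linear
import HarnessLib

/-!
# `TwoAdicBianchiProModularityLevel` (crux stmt-Langlands-15110, route `ParityBlindBianchi`) —
# HECKE POLYNOMIALS ARE NILPOTENT-EXACT UNDER LEVEL CHANGE (`k`-coefficients, untwisted model)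

Generic vocabulary of `ArithmeticQuotientCohomology` (`ι : Γ → 𝒢`, levels `L' ≤ L ≤ 𝒢`, `L'` NORMAL
in `L`, coefficients `M`, Hecke elements `δ : J → 𝒢`) and abstract Hecke operators `P ∈ k⟨T_j⟩` (free
`k`-algebra, as in `IsHeckePoint` / `isHeckePoint_iff_forall_freeAlgebra`).  The tree proves the
Hochschild–Serre reduction of [Scholze2015, §V.4, proof of Thm. V.4.1] spectral-sequence-free in the
TWISTED model for an arbitrary endomorphism of `W = Fun(𝒢 ⧸ L', M) ∈ Rep k (Γ × L ⧸ L')`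
(`TwistedQuotient.pow_succ_map_toLevel_eq_zero`); this file specialises it to `P((heckeProdHom δ_j)_j)`
for `k`-LINEAR combinations of Hecke monomials and transports it to the UNTWISTED model of the crux's
big Hecke algebra: §1 `groupCohomology_map_id_smul` (`Hⁿ(G, r • φ) = r • Hⁿ(G, φ)`; Mathlib has only
`ShortComplex.homologyMap_smul`), `exists_mapEndAlgHom`, `exists_conjAlgHom`; §2
`map_lift_heckeRepHom_hom`, `toLevel'_smul`, `toLevel_smul` (so `toLevel'`, `toLevel` are `k`-algebra maps), `toLevel'_lift_heckeProdHom`,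
`toLevel_lift_heckeProdHom`; §3 **`pow_succ_lift_heckeEnd_eq_zero`**: `P((T_{δ j})_j) = 0` on
`H^{≤ q}(X_{L'}, M)` ⇒ `P((T_{δ j})_j)^{q+1} = 0` on `H^q(X_L, M)` (Hecke elements with
`l δ_j l⁻¹ ∈ L' δ_j L'`, corresponding finite double cosets); §3b `crux_pow_succ_lift_heckeEnd_eq_zero`
(crux's literal setting, registered sub-goal).  Used by `…CoarseTowerTransfer` (degree-bounded points
of `Spf 𝕋` of a coarser tower are points of `Spf 𝕋` of the principal tower, whatever the indices).
Existence forms keep the file definition-free.  Sorry-free; lead a1 (line `SketchIdeator4`, cycle 1).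

## References

* P. Scholze, Ann. of Math. 182 (2015), §V.4, proof of Thm. V.4.1 [Scholze2015].
* G. Shimura, *Introduction to the arithmetic theory of automorphic functions* (1971), Ch. 3, Prop. 3.1
  [ShimuraIATAF1971].
-/


noncomputable section

set_option linter.dupNamespace false

namespace Summit.Langlands.Langlands.Theorems.TwoAdicBianchiProModularityLevel

open CategoryTheory Literature.NumberTheory.Automorphic

universe u v

/-! ### §1 `k`-linearity of group cohomology in the morphism; `Hⁿ` as an algebra homomorphism -/

section Smul

variable {k G : Type u} [CommRing k] [Group G] {A B : Rep k G}

/-- `cochainsMap` is `k`-linear in the morphism (along the identity of `G`). [folklore] -/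
theorem cochainsMap_id_smul (r : k) (φ : A ⟶ B) :
    groupCohomology.cochainsMap (MonoidHom.id G) (r • φ) =
      r • groupCohomology.cochainsMap (MonoidHom.id G) φ := by
  ext i : 1
  simp only [HomologicalComplex.smul_f_apply]
  ext x g
  simp [groupCohomology.cochainsMap, Rep.smul_hom]

/-- `HomologicalComplex.homologyMap` is `k`-linear in the morphism (Mathlib has the short-complex
case `ShortComplex.homologyMap_smul`). [folklore] -/
theorem homologyMap_smul {C : Type*} [Category C] [Preadditive C] [Linear k C]
    {ι : Type*} {c : ComplexShape ι} {K L : HomologicalComplex C c} (r : k) (ψ : K ⟶ L) (i : ι)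
    [K.HasHomology i] [L.HasHomology i] :
    HomologicalComplex.homologyMap (r • ψ) i = r • HomologicalComplex.homologyMap ψ i := by
  have h : (HomologicalComplex.shortComplexFunctor C c i).map (r • ψ) =
      r • (HomologicalComplex.shortComplexFunctor C c i).map ψ := by ext <;> rfl
  change ShortComplex.homologyMap ((HomologicalComplex.shortComplexFunctor C c i).map (r • ψ)) = _
  rw [h, ShortComplex.homologyMap_smul]
  rfl

/-- **Group cohomology is `k`-linear in the morphism**: `Hⁿ(G, r • φ) = r • Hⁿ(G, φ)`. [folklore] -/
theorem groupCohomology_map_id_smul (r : k) (φ : A ⟶ B) (n : ℕ) :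
    groupCohomology.map (MonoidHom.id G) (r • φ) n = r • groupCohomology.map (MonoidHom.id G) φ n := by
  change HomologicalComplex.homologyMap (groupCohomology.cochainsMap (MonoidHom.id G) (r • φ)) n = _
  rw [cochainsMap_id_smul, homologyMap_smul]; rfl

variable (A) in
/-- **`Hⁿ(G, ·)` on endomorphisms is a `k`-algebra homomorphism** `End A → End_k Hⁿ(G, A)`
(functoriality, additivity and `k`-linearity of group cohomology); stated as an existence so that this
file introduces no definition. [folklore] -/
theorem exists_mapEndAlgHom (n : ℕ) :
    ∃ F : End A →ₐ[k] Module.End k (groupCohomology A n),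
      ∀ φ : End A, F φ = (groupCohomology.map (MonoidHom.id G) φ n).hom :=
  ⟨{ toFun := fun φ => (groupCohomology.map (MonoidHom.id G) φ n).hom
     map_one' := by
       show (groupCohomology.map (MonoidHom.id G) (𝟙 A) n).hom = _
       rw [groupCohomology.map_id]; rfl
     map_mul' := fun φ ψ => by
       show (groupCohomology.map (MonoidHom.id G) ((ψ : A ⟶ A) ≫ φ) n).hom = _
       rw [groupCohomology.map_id_comp, ModuleCat.hom_comp]; rfl
     map_zero' := by
       show ((groupCohomology.functor k G n).map (0 : A ⟶ A)).hom = 0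
       rw [Functor.map_zero]; rfl
     map_add' := fun φ ψ => by
       show (HomologicalComplex.homologyMap ((groupCohomology.cochainsFunctor k G).map
         (@HAdd.hAdd (A ⟶ A) (A ⟶ A) (A ⟶ A) _ φ ψ)) n).hom = _
       rw [Functor.map_add, HomologicalComplex.homologyMap_add]; rfl
     commutes' := fun r => by
       show (groupCohomology.map (MonoidHom.id G) (r • 𝟙 A) n).hom = _
       rw [groupCohomology_map_id_smul, groupCohomology.map_id, Module.algebraMap_end_eq_smul_id]
       rfl }, fun _ => rfl⟩

/-- **Conjugation by an isomorphism** in a `k`-linear category is a `k`-algebra homomorphism of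
endomorphism algebras `φ ↦ e⁻¹ ≫ φ ≫ e` (existence form). [folklore] -/
theorem exists_conjAlgHom {C : Type*} [Category C] [Preadditive C] [Linear k C] {X Y : C} (e : X ≅ Y) :
    ∃ F : End X →ₐ[k] End Y, ∀ φ : End X, F φ = e.inv ≫ φ ≫ e.hom :=
  ⟨{ toFun := fun φ => e.inv ≫ φ ≫ e.hom
     map_one' := by
       show e.inv ≫ 𝟙 X ≫ e.hom = 𝟙 Y
       rw [Category.id_comp, Iso.inv_hom_id]
     map_mul' := fun φ ψ => by
       show e.inv ≫ ((ψ : X ⟶ X) ≫ φ) ≫ e.hom = (e.inv ≫ ψ ≫ e.hom) ≫ (e.inv ≫ φ ≫ e.hom)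
       simp only [Category.assoc, Iso.hom_inv_id_assoc]
     map_zero' := by
       show e.inv ≫ (0 : X ⟶ X) ≫ e.hom = 0
       rw [Limits.zero_comp, Limits.comp_zero]
     map_add' := fun φ ψ => by
       show e.inv ≫ (@HAdd.hAdd (X ⟶ X) (X ⟶ X) (X ⟶ X) _ φ ψ) ≫ e.hom =
         (e.inv ≫ φ ≫ e.hom) + (e.inv ≫ ψ ≫ e.hom)
       rw [Preadditive.add_comp, Preadditive.comp_add]
     commutes' := fun r => by
       show e.inv ≫ (r • 𝟙 X) ≫ e.hom = r • 𝟙 Y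
       rw [Linear.smul_comp, Linear.comp_smul, Category.id_comp, Iso.inv_hom_id] }, fun _ => rfl⟩

end Smul

/-! ### §2 Abstract Hecke operators realised on the coefficients and on the level-change
representation `W = Fun(𝒢 ⧸ L', M) ∈ Rep k (Γ × L ⧸ L')` -/

section Realise

variable {k Γ 𝒢 : Type u} [CommRing k] [Group Γ] [Group 𝒢] (ι : Γ →* 𝒢)
  {L' L : Subgroup 𝒢} (hle : L' ≤ L) [hN : (L'.subgroupOf L).Normal]
  (M : Type u) [AddCommGroup M] [Module k M] {J : Type v} (δ : J → 𝒢)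

/-- **Realisation before cohomology.**  The abstract Hecke operator `P ∈ k⟨T_j : j ∈ J⟩` realised on
the coefficient representation `Fun(𝒢 ⧸ L, M)` through `T_j ↦ [L δ_j L]` (an endomorphism of the
`Γ`-representation) acts on `Hⁱ(X_L, M)` as `P` evaluated at the Hecke operators `T_{δ j}` on
`Hⁱ(X_L, M)` (both are `k`-algebra homomorphisms agreeing on the generators). [folklore] -/
theorem map_lift_heckeRepHom_hom (L : Subgroup 𝒢) (P : FreeAlgebra k J) (i : ℕ) :
    (groupCohomology.map (A := ArithmeticQuotient.coeffRep k ι L M) (MonoidHom.id Γ)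
      (FreeAlgebra.lift k (A := End (ArithmeticQuotient.coeffRep k ι L M))
        (fun j => ArithmeticQuotient.heckeRepHom k L (δ j) M ι) P)
          i).hom =
      FreeAlgebra.lift k (fun j => ArithmeticQuotient.heckeEnd k L (δ j) M ι i) P := by
  obtain ⟨F, hF⟩ := exists_mapEndAlgHom (ArithmeticQuotient.coeffRep k ι L M) i
  rw [← hF]
  change (F.comp (FreeAlgebra.lift k (A := End (ArithmeticQuotient.coeffRep k ι L M))
    fun j => ArithmeticQuotient.heckeRepHom k L (δ j) M ι)) P = _
  congr 1
  refine FreeAlgebra.hom_ext (funext fun j => ?_)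
  simp only [Function.comp_apply, AlgHom.comp_apply, FreeAlgebra.lift_ι_apply]
  rw [hF]

/-- `toLevel'` is `k`-linear: `toLevel' (r • φ') = r • toLevel' φ'` (restriction along `Γ → Γ × L/L'`
is a `k`-linear functor). [folklore] -/
theorem toLevel'_smul (r : k)
    (φ' : TwistedQuotient.levelProd ι hle (1 : Representation k Γ M) ⟶
      TwistedQuotient.levelProd ι hle (1 : Representation k Γ M)) :
    TwistedQuotient.toLevel' ι hle (1 : Representation k Γ M) (r • φ') =
      r • TwistedQuotient.toLevel' ι hle (1 : Representation k Γ M) φ' := by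
  change (TwistedQuotient.resFstIso ι hle (1 : Representation k Γ M)).inv ≫
      (Rep.resFunctor (MonoidHom.inl Γ (L ⧸ L'.subgroupOf L))).map (r • φ') ≫
        (TwistedQuotient.resFstIso ι hle (1 : Representation k Γ M)).hom =
    r • ((TwistedQuotient.resFstIso ι hle (1 : Representation k Γ M)).inv ≫
      (Rep.resFunctor (MonoidHom.inl Γ (L ⧸ L'.subgroupOf L))).map φ' ≫
        (TwistedQuotient.resFstIso ι hle (1 : Representation k Γ M)).hom)
  rw [Functor.map_smul, Linear.smul_comp, Linear.comp_smul]

/-- `toLevel` is `k`-linear: `toLevel (r • φ') = r • toLevel φ'` (descent of invariant functions is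
linear). [folklore] -/
theorem toLevel_smul (r : k)
    (φ' : TwistedQuotient.levelProd ι hle (1 : Representation k Γ M) ⟶
      TwistedQuotient.levelProd ι hle (1 : Representation k Γ M)) :
    TwistedQuotient.toLevel ι hle (1 : Representation k Γ M) (r • φ') =
      r • TwistedQuotient.toLevel ι hle (1 : Representation k Γ M) φ' := by
  refine Rep.hom_ext (Representation.IntertwiningMap.ext (LinearMap.ext fun f => ?_))
  change (TwistedQuotient.toLevel ι hle (1 : Representation k Γ M) (r • φ')).hom f =
    r • (TwistedQuotient.toLevel ι hle (1 : Representation k Γ M) φ').hom f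
  rw [TwistedQuotient.toLevel_hom_apply, TwistedQuotient.toLevel_hom_apply]
  funext c
  induction c using QuotientGroup.induction_on with
  | H x => rfl

variable (hconj : ∀ (j : J) (l : L), ∃ a ∈ L', ∃ b ∈ L', (l : 𝒢) * δ j * (l : 𝒢)⁻¹ = a * δ j * b)
  (hfin' : ∀ j : J, (ArithmeticQuotient.doubleCosetQuot L' (δ j)).Finite)

include hconj hfin' in
/-- **At level `L'`**: the abstract Hecke operator `P` realised on the level-change representation
`W = Fun(𝒢 ⧸ L', M)` of `Γ × (L ⧸ L')` (through the tree's `heckeProdHom`, which needs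
`l δ_j l⁻¹ ∈ L' δ_j L'` for `l ∈ L` and `L' δ_j L' / L'` finite) restricts, on `W|_Γ`, to `P` realised on
the coefficients of level `L'` — transported to the twisted model along `coeffRepIsoTwisted` (on
generators: `toLevel'_heckeProdHom`). [folklore] -/
theorem toLevel'_lift_heckeProdHom (P : FreeAlgebra k J) :
    TwistedQuotient.toLevel' ι hle (1 : Representation k Γ M)
        (FreeAlgebra.lift k (A := End (TwistedQuotient.levelProd ι hle (1 : Representation k Γ M)))
          (fun j => TwistedQuotient.heckeProdHom ι hle (1 : Representation k Γ M) (hconj j) (hfin' j)) P) =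
      (ArithmeticQuotient.coeffRepIsoTwisted k ι L' M).inv ≫
        (FreeAlgebra.lift k (A := End (ArithmeticQuotient.coeffRep k ι L' M))
          (fun j => ArithmeticQuotient.heckeRepHom k L' (δ j) M ι) P : End _) ≫
        (ArithmeticQuotient.coeffRepIsoTwisted k ι L' M).hom := by
  obtain ⟨F, hF⟩ : ∃ F : End (TwistedQuotient.levelProd ι hle (1 : Representation k Γ M)) →ₐ[k]
      End (TwistedQuotient.coeffRep ι L' (1 : Representation k Γ M)),
        ∀ φ', F φ' = TwistedQuotient.toLevel' ι hle (1 : Representation k Γ M) φ' :=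
    ⟨AlgHom.mk' (TwistedQuotient.toLevel'RingHom ι hle _) (toLevel'_smul ι hle M), fun _ => rfl⟩
  obtain ⟨C, hC⟩ := exists_conjAlgHom (k := k) (ArithmeticQuotient.coeffRepIsoTwisted k ι L' M)
  have hFC : F.comp (FreeAlgebra.lift k (A := End (TwistedQuotient.levelProd ι hle (1 : Representation k Γ M)))
        fun j => TwistedQuotient.heckeProdHom ι hle (1 : Representation k Γ M) (hconj j) (hfin' j)) =
      C.comp (FreeAlgebra.lift k (A := End (ArithmeticQuotient.coeffRep k ι L' M))
        fun j => ArithmeticQuotient.heckeRepHom k L' (δ j) M ι) := by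
    refine FreeAlgebra.hom_ext (funext fun j => ?_)
    simp only [Function.comp_apply, AlgHom.comp_apply, FreeAlgebra.lift_ι_apply]
    rw [hF, hC]
    change TwistedQuotient.toLevel' ι hle (1 : Representation k Γ M)
        (TwistedQuotient.heckeProdHom ι hle (1 : Representation k Γ M) (hconj j) (hfin' j)) =
      (ArithmeticQuotient.coeffRepIsoTwisted k ι L' M).inv ≫
        ArithmeticQuotient.heckeRepHom k L' (δ j) M ι ≫ (ArithmeticQuotient.coeffRepIsoTwisted k ι L' M).hom
    rw [TwistedQuotient.toLevel'_heckeProdHom, ArithmeticQuotient.heckeRepHom_comp_coeffRepIsoTwisted,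
      Iso.inv_hom_id_assoc]
  have h := AlgHom.congr_fun hFC P
  rw [AlgHom.comp_apply, AlgHom.comp_apply, hF, hC] at h
  exact h

include hconj hfin' in
/-- **At level `L`**: the same realisation restricts, on the `L ⧸ L'`-invariants `W^{L/L'} = Fun(𝒢 ⧸ L, M)`,
to `P` realised on the coefficients of level `L` (transported to the twisted model), as soon as
`L' δ_j L' / L' → L δ_j L / L` is bijective onto a finite set (on generators: `toLevel_heckeProdHom`).
[cite: ShimuraIATAF1971, Ch. 3, Prop. 3.1] -/
theorem toLevel_lift_heckeProdHom
    (hbij : ∀ j : J, Set.BijOn (fun c => (1 : 𝒢)⁻¹ • ArithmeticQuotient.translateQuot (1 : 𝒢)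
        (ArithmeticQuotient.conjInto_one_iff.2 hle) c)
      (ArithmeticQuotient.doubleCosetQuot L' (δ j)) (ArithmeticQuotient.doubleCosetQuot L (δ j)))
    (hfin : ∀ j : J, (ArithmeticQuotient.doubleCosetQuot L (δ j)).Finite) (P : FreeAlgebra k J) :
    TwistedQuotient.toLevel ι hle (1 : Representation k Γ M)
        (FreeAlgebra.lift k (A := End (TwistedQuotient.levelProd ι hle (1 : Representation k Γ M)))
          (fun j => TwistedQuotient.heckeProdHom ι hle (1 : Representation k Γ M) (hconj j) (hfin' j)) P) =
      (ArithmeticQuotient.coeffRepIsoTwisted k ι L M).inv ≫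
        (FreeAlgebra.lift k (A := End (ArithmeticQuotient.coeffRep k ι L M))
          (fun j => ArithmeticQuotient.heckeRepHom k L (δ j) M ι) P : End _) ≫
        (ArithmeticQuotient.coeffRepIsoTwisted k ι L M).hom := by
  obtain ⟨F, hF⟩ : ∃ F : End (TwistedQuotient.levelProd ι hle (1 : Representation k Γ M)) →ₐ[k]
      End (TwistedQuotient.coeffRep ι L (1 : Representation k Γ M)),
        ∀ φ', F φ' = TwistedQuotient.toLevel ι hle (1 : Representation k Γ M) φ' :=
    ⟨AlgHom.mk' (TwistedQuotient.toLevelRingHom ι hle _) (toLevel_smul ι hle M), fun _ => rfl⟩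
  obtain ⟨C, hC⟩ := exists_conjAlgHom (k := k) (ArithmeticQuotient.coeffRepIsoTwisted k ι L M)
  have hFC : F.comp (FreeAlgebra.lift k (A := End (TwistedQuotient.levelProd ι hle (1 : Representation k Γ M)))
        fun j => TwistedQuotient.heckeProdHom ι hle (1 : Representation k Γ M) (hconj j) (hfin' j)) =
      C.comp (FreeAlgebra.lift k (A := End (ArithmeticQuotient.coeffRep k ι L M))
        fun j => ArithmeticQuotient.heckeRepHom k L (δ j) M ι) := by
    refine FreeAlgebra.hom_ext (funext fun j => ?_)
    simp only [Function.comp_apply, AlgHom.comp_apply, FreeAlgebra.lift_ι_apply]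
    rw [hF, hC]
    change TwistedQuotient.toLevel ι hle (1 : Representation k Γ M)
        (TwistedQuotient.heckeProdHom ι hle (1 : Representation k Γ M) (hconj j) (hfin' j)) =
      (ArithmeticQuotient.coeffRepIsoTwisted k ι L M).inv ≫
        ArithmeticQuotient.heckeRepHom k L (δ j) M ι ≫ (ArithmeticQuotient.coeffRepIsoTwisted k ι L M).hom
    rw [TwistedQuotient.toLevel_heckeProdHom ι hle _ (hconj j) (hfin' j) (hbij j) (hfin j),
      ArithmeticQuotient.heckeRepHom_comp_coeffRepIsoTwisted, Iso.inv_hom_id_assoc]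
  have h := AlgHom.congr_fun hFC P
  rw [AlgHom.comp_apply, AlgHom.comp_apply, hF, hC] at h
  exact h

/-! ### §3 Level change is nilpotent-exact for abstract Hecke operators with `k`-coefficients -/

include hle hconj hfin' in
/-- **A Hecke polynomial killing `H^{≤ q}(X_{L'}, M)` has `(q+1)`-st power zero on `H^q(X_L, M)`.**
For `L' ≤ L` with `L'` normal in `L`, Hecke elements `δ_j` with `l δ_j l⁻¹ ∈ L' δ_j L'` (`l ∈ L`) and
`L' δ_j L'/L' → L δ_j L/L` bijective onto a finite set, and `P` in the free `k`-algebra on `J`: if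
`P((T_{δ j})_j) = 0` on `H^b(X_{L'}, M)` for all `b ≤ q`, then `P((T_{δ j})_j)^{q+1} = 0` on
`H^q(X_L, M)` — the Hochschild–Serre reduction of [Scholze2015, §V.4, proof of Thm. V.4.1]
(`TwistedQuotient.pow_succ_map_toLevel_eq_zero`) for the untwisted function model of
`CompletedCohomology` and `k`-linear combinations of Hecke monomials. [cite: Scholze2015, §V.4, proof of Thm. V.4.1] -/
theorem pow_succ_lift_heckeEnd_eq_zero
    (hbij : ∀ j : J, Set.BijOn (fun c => (1 : 𝒢)⁻¹ • ArithmeticQuotient.translateQuot (1 : 𝒢)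
        (ArithmeticQuotient.conjInto_one_iff.2 hle) c)
      (ArithmeticQuotient.doubleCosetQuot L' (δ j)) (ArithmeticQuotient.doubleCosetQuot L (δ j)))
    (hfin : ∀ j : J, (ArithmeticQuotient.doubleCosetQuot L (δ j)).Finite)
    (P : FreeAlgebra k J) (q : ℕ)
    (hP : ∀ b ≤ q, FreeAlgebra.lift k (fun j => ArithmeticQuotient.heckeEnd k L' (δ j) M ι b) P = 0) :
    FreeAlgebra.lift k (fun j => ArithmeticQuotient.heckeEnd k L (δ j) M ι q) P ^ (q + 1) = 0 := by
  set φ' := FreeAlgebra.lift k (A := End (TwistedQuotient.levelProd ι hle (1 : Representation k Γ M)))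
    (fun j => TwistedQuotient.heckeProdHom ι hle (1 : Representation k Γ M) (hconj j) (hfin' j)) P
  set e' := ArithmeticQuotient.coeffRepIsoTwisted k ι L' M
  set e := ArithmeticQuotient.coeffRepIsoTwisted k ι L M
  set R' := FreeAlgebra.lift k (A := End (ArithmeticQuotient.coeffRep k ι L' M))
    (fun j => ArithmeticQuotient.heckeRepHom k L' (δ j) M ι) P
  set R := FreeAlgebra.lift k (A := End (ArithmeticQuotient.coeffRep k ι L M))
    (fun j => ArithmeticQuotient.heckeRepHom k L (δ j) M ι) P
  have h' : TwistedQuotient.toLevel' ι hle (1 : Representation k Γ M) φ' = e'.inv ≫ (R' : _ ⟶ _) ≫ e'.hom :=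
    toLevel'_lift_heckeProdHom ι hle M δ hconj hfin' P
  have h : TwistedQuotient.toLevel ι hle (1 : Representation k Γ M) φ' = e.inv ≫ (R : _ ⟶ _) ≫ e.hom :=
    toLevel_lift_heckeProdHom ι hle M δ hconj hfin' hbij hfin P
  -- the hypothesis of the nilpotence theorem: `P` kills `H^{≤ q}(X_{L'}, M)`
  have hφ : ∀ b ≤ q, groupCohomology.map (A := TwistedQuotient.coeffRep ι L' (1 : Representation k Γ M))
      (MonoidHom.id Γ) (TwistedQuotient.toLevel' ι hle (1 : Representation k Γ M) φ') b = 0 := by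
    intro b hb
    have h0 : groupCohomology.map (A := ArithmeticQuotient.coeffRep k ι L' M) (MonoidHom.id Γ)
        (R' : _ ⟶ _) b = 0 := by
      apply ModuleCat.hom_ext
      rw [ModuleCat.hom_zero, map_lift_heckeRepHom_hom, hP b hb]
    rw [h', groupCohomology.map_id_comp, groupCohomology.map_id_comp, h0, Limits.zero_comp,
      Limits.comp_zero]
  have hnil := TwistedQuotient.pow_succ_map_toLevel_eq_zero ι hle (1 : Representation k Γ M) φ' q hφ
  -- name the three maps on `H^q`: `A = H^q(e)`, `B = H^q(e⁻¹)`, `T = P((T_{δ j})_j)` at level `L`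
  set A := (groupCohomology.map (A := ArithmeticQuotient.coeffRep k ι L M) (MonoidHom.id Γ)
    e.hom q).hom
  set B := (groupCohomology.map (A := TwistedQuotient.coeffRep ι L (1 : Representation k Γ M))
    (MonoidHom.id Γ) e.inv q).hom
  set T := FreeAlgebra.lift k (fun j => ArithmeticQuotient.heckeEnd k L (δ j) M ι q) P with hTdef
  have hBA : B ∘ₗ A = LinearMap.id := by
    have h1 : (groupCohomology.functor k Γ q).map e.hom ≫ (groupCohomology.functor k Γ q).map e.inv =
        𝟙 _ := by
      rw [← Functor.map_comp, Iso.hom_inv_id, CategoryTheory.Functor.map_id]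
    have h2 := congrArg ModuleCat.Hom.hom h1
    rw [ModuleCat.hom_comp] at h2
    exact h2
  have hT : (groupCohomology.map (A := ArithmeticQuotient.coeffRep k ι L M) (MonoidHom.id Γ)
      (R : _ ⟶ _) q).hom = T := by
    rw [hTdef, map_lift_heckeRepHom_hom]
  have hdec : (groupCohomology.map (A := TwistedQuotient.coeffRep ι L (1 : Representation k Γ M))
      (MonoidHom.id Γ) (TwistedQuotient.toLevel ι hle (1 : Representation k Γ M) φ') q).hom =
        A ∘ₗ T ∘ₗ B := by
    rw [h, groupCohomology.map_id_comp, groupCohomology.map_id_comp, ModuleCat.hom_comp,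
      ModuleCat.hom_comp, hT]
    rfl
  rw [hdec, TwistedQuotient.pow_succ_conj_eq A B T hBA q] at hnil
  calc T ^ (q + 1) = (B ∘ₗ A) ∘ₗ (T ^ (q + 1)) ∘ₗ (B ∘ₗ A) := by
        rw [hBA, LinearMap.id_comp, LinearMap.comp_id]
    _ = B ∘ₗ (A ∘ₗ (T ^ (q + 1)) ∘ₗ B) ∘ₗ A := rfl
    _ = 0 := by rw [hnil, LinearMap.zero_comp, LinearMap.comp_zero]

end Realise

/-! ### §3b The crux's setting: `Γ = GL₂(K) → GL₂(𝔸_K^∞)`, Hecke family `(t_{v,i+1})_f`, `k = ℤ̄₂` -/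

section Crux

open scoped NumberField
open IsDedekindDomain

/-- **Hecke polynomials are nilpotent-exact under level change, in the crux's vocabulary** (registered
sub-goal).  For `Γ = GL₂(K) → 𝒢 = GL₂(𝔸_K^∞)` diagonally, levels `L' ≤ L ≤ 𝒢` with `L'` normal in `L`
(for the crux: `L' = U ∩ K((2)^s)` a principal `2`-power level, `L` any level between it and `U`), the
Hecke family `(v, i) ↦ (t_{v,i+1})_f` over a type `S` of (good) places with the usual adelic plumbing
(`l t l⁻¹ ∈ L' t L'`, corresponding finite double cosets), coefficients any `ℤ̄₂`-module `M`: a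
noncommutative `ℤ̄₂`-polynomial `P` in the `T_{v,i}` vanishing on `H^b(X_{L'}, M)` for all `b ≤ q` has
`P^{q+1} = 0` on `H^q(X_L, M)`. [cite: Scholze2015, §V.4, proof of Thm. V.4.1] -/
theorem crux_pow_succ_lift_heckeEnd_eq_zero : ∀ (K : Type) [Field K] [NumberField K]
    (L' L : Subgroup (GL (Fin 2) (FiniteAdeleRing (𝓞 K) K))) (hle : L' ≤ L)
    [(L'.subgroupOf L).Normal]
    (M : Type) [AddCommGroup M] [Module (PadicAlgCl.valued 2).v.valuationSubring M]
    (S : Type) (pl : S → HeightOneSpectrum (𝓞 K))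
    (ϖ : ∀ v : HeightOneSpectrum (𝓞 K), (v.adicCompletion K)ˣ),
    (∀ (j : S × Fin 2) (l : L), ∃ a' ∈ L', ∃ b' ∈ L',
      (l : GL (Fin 2) (FiniteAdeleRing (𝓞 K) K)) *
          GLn.sndHom 2 K (heckeDiagAt 2 K (pl j.1) (ϖ (pl j.1)) (j.2.val + 1)) * (l : _)⁻¹ =
        a' * GLn.sndHom 2 K (heckeDiagAt 2 K (pl j.1) (ϖ (pl j.1)) (j.2.val + 1)) * b') →
    (∀ j : S × Fin 2, (ArithmeticQuotient.doubleCosetQuot L'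
      (GLn.sndHom 2 K (heckeDiagAt 2 K (pl j.1) (ϖ (pl j.1)) (j.2.val + 1)))).Finite) →
    (∀ j : S × Fin 2, Set.BijOn (fun c => (1 : GL (Fin 2) (FiniteAdeleRing (𝓞 K) K))⁻¹ •
        ArithmeticQuotient.translateQuot (1 : GL (Fin 2) (FiniteAdeleRing (𝓞 K) K))
          (ArithmeticQuotient.conjInto_one_iff.2 hle) c)
      (ArithmeticQuotient.doubleCosetQuot L'
        (GLn.sndHom 2 K (heckeDiagAt 2 K (pl j.1) (ϖ (pl j.1)) (j.2.val + 1))))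
      (ArithmeticQuotient.doubleCosetQuot L
        (GLn.sndHom 2 K (heckeDiagAt 2 K (pl j.1) (ϖ (pl j.1)) (j.2.val + 1))))) →
    (∀ j : S × Fin 2, (ArithmeticQuotient.doubleCosetQuot L
      (GLn.sndHom 2 K (heckeDiagAt 2 K (pl j.1) (ϖ (pl j.1)) (j.2.val + 1)))).Finite) →
    ∀ (P : FreeAlgebra (PadicAlgCl.valued 2).v.valuationSubring (S × Fin 2)) (q : ℕ),
    (∀ b ≤ q, FreeAlgebra.lift (PadicAlgCl.valued 2).v.valuationSubring
      (fun j : S × Fin 2 => ArithmeticQuotient.heckeEnd (PadicAlgCl.valued 2).v.valuationSubring L'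
        (GLn.sndHom 2 K (heckeDiagAt 2 K (pl j.1) (ϖ (pl j.1)) (j.2.val + 1))) M
        (Matrix.GeneralLinearGroup.map (algebraMap K (FiniteAdeleRing (𝓞 K) K)) :
          GL (Fin 2) K →* GL (Fin 2) (FiniteAdeleRing (𝓞 K) K)) b) P = 0) →
    FreeAlgebra.lift (PadicAlgCl.valued 2).v.valuationSubring
      (fun j : S × Fin 2 => ArithmeticQuotient.heckeEnd (PadicAlgCl.valued 2).v.valuationSubring L
        (GLn.sndHom 2 K (heckeDiagAt 2 K (pl j.1) (ϖ (pl j.1)) (j.2.val + 1))) M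
        (Matrix.GeneralLinearGroup.map (algebraMap K (FiniteAdeleRing (𝓞 K) K)) :
          GL (Fin 2) K →* GL (Fin 2) (FiniteAdeleRing (𝓞 K) K)) q) P ^ (q + 1) = 0 := by
  intro K _ _ L' L hle _ M _ _ S pl ϖ hconj hfin' hbij hfin P q hP
  exact pow_succ_lift_heckeEnd_eq_zero
    (Matrix.GeneralLinearGroup.map (algebraMap K (FiniteAdeleRing (𝓞 K) K)) :
      GL (Fin 2) K →* GL (Fin 2) (FiniteAdeleRing (𝓞 K) K))
    hle M (fun j : S × Fin 2 => GLn.sndHom 2 K (heckeDiagAt 2 K (pl j.1) (ϖ (pl j.1)) (j.2.val + 1)))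
    hconj hfin' hbij hfin P q hP

end Crux


end Summit.Langlands.Langlands.Theorems.TwoAdicBianchiProModularityLevel

end
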